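import Summits.ResolutionOfSingularities.ResolutionOfSingularities.Theorems.HomologicalConductorNoZenoSandwichedGerm
import HarnessLib

/-!
# Route `HomologicalConductor`, crux `NoZenoR` (stmt-ResolutionOfSingularities-19943; aside twin `NoZeno` 16483):
# ENTRY into the sandwiched habitat — a germ dominating a regular surface germ of `K` is sandwiched

`[OURS · L W4.4]` Cell res-hironaka, crux chain W4.4, object (ρ31e)(n2) «(EP) typed help» (planner
res-L0-w44-plan-1, (V26) «habitat cut», entry stub `stub_HabExSw₀`), executed by res-L0-w44-stub-3; sequel of
`…Theorems.HomologicalConductorNoZenoSandwichedGerm` (p531756).  Nothing here is a statement of the manuscript under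
review (Hironaka 2017); AI-written, weaker than expert review.

The printed precedent of the habitat entry is Lipman 1969, Theorem (2.1), HAB-step (p. 202 L36–40, as read by
res-L0-w44-tri-1 12:31:56Z): «v dominates B_p … essentially of finite type over a regular local ring A with quotient
field K.  Since R_v = ∪R_n contains B, for all sufficiently large n … R_n dominates B_p; then for m ≥ n, R_m is
essentially of finite type over A, whence, by 1) of Proposition (1.2), R_m has a rational singularity».  The
thread analogue splits into a uniformization input (a regular two-dimensional `k`-subalgebra `R` of `K` with
`Frac R = K`, from surface local uniformization over `k₁ = k(w)`), the OPEN containment «`R ⊆ D_N` with `D_N`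
dominating `R`» (the ideators' `Sig.KUnionThread`-type target, (ρ31d)), and the PLUMBING typed here:

* `IsSandwichedGerm.of_dominated_subalgebra` — for `k`-subalgebras `R ≤ D` of `K` with `R` regular local of
  dimension `2`, `Frac R = K`, `D` essentially of finite type over `k` and DOMINATING `R` (the inclusion reflects
  units): `IsSandwichedGerm ↥D` (`φ` = the inclusion; essentially of finite type by `Algebra.EssFiniteType.of_comp`
  over `k`; birational because `Frac R = K ⊇ D`).
* `isSandwichedGerm_locPrime_of_dominated` — the same for a thread germ `D_m = Parasite.locPrime (tower O A m) (P m)`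
  (a subring of `K`, essentially of finite type over `k` by `tn_tower_invariant` + localisation): if `D_m ⊇ R`
  dominates such an `R`, then `D_m` is sandwiched — and then every later germ is (`isSandwichedGerm_locPrime_of_le`)
  and, past the escape stage, rational (`hasRationalSingularity_locPrime_of_isSandwichedGerm`): the entry stub
  `stub_HabExSw₀` follows from a `Sig.KUnionThread`-type containment by ONE application.
* §Exhaustion — **EXHAUSTION LOCALISES THE THREAD** (`exists_coarsening_of_exhausts`): if the stages exhaust `O`
  (`Parasite.Exhausts O A`: `⋃ T_m = O`), then for every compatible prime thread the union `⋃_m D_m` IS a valuation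
  ring of `K` — the coarsening `W = O_𝔔` of `O` at the thread prime `𝔔 = ⋃_m P_m` (Mathlib `ValuationSubring.ofPrime`)
  — containing and DOMINATING every `D_m` (`SubringDominates`).  So in the exhaustive case the (K∪-thread) input
  holds in its strongest form and the thread is the thread of centres of `W`; with `mem_thread_iff_of_le`
  (membership in a compatible thread is stage-independent).

References: J. Lipman, Publ. Math. IHÉS 36 (1969), Thm. (2.1) pp. 201–203 [`Lipman1969`] (precedent only; nothing
of it is typed here); M. Spivakovsky, Ann. of Math. 131 (1990) [`Spivakovsky1990`] (terminology).
-/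

-- single-problem summit: the doubled namespace component `ResolutionOfSingularities` is forced
set_option linter.dupNamespace false

noncomputable section

open IsLocalRing
open Literature.AlgebraicGeometry.Resolution

namespace Summit.ResolutionOfSingularities.ResolutionOfSingularities.Theorems.NoZeno.Sandwiched

variable {k K : Type} [Field k] [Field K] [Algebra k K]

/-! ## Abstract entry: dominating a regular two-dimensional `k`-subalgebra of `K` -/

/-- **ENTRY INTO THE HABITAT**: a `k`-subalgebra `D` of `K`, essentially of finite type over `k`, which contains and
DOMINATES a regular local `k`-subalgebra `R` of Krull dimension `2` with `Frac R = K`, is sandwiched (`φ` = the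
inclusion `R → D`: injective; essentially of finite type by `Algebra.EssFiniteType.of_comp` applied to
`k → R → D`; birational since every element of `D ⊆ K = Frac R` is a fraction of elements of `R`; unit-reflecting
by hypothesis).  Lipman (2.1) HAB-step, abstract form. [this work] -/
theorem IsSandwichedGerm.of_dominated_subalgebra (R D : Subalgebra k K) (hRD : R ≤ D)
    [IsRegularLocalRing ↥R] (hdim : ringKrullDim ↥R = 2) (hfr : IsFractionRing ↥R K)
    [Algebra.EssFiniteType k ↥D]
    (hdom : ∀ r : ↥R, IsUnit (Subalgebra.inclusion hRD r) → IsUnit r) :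
    IsSandwichedGerm ↥D := by
  haveI := hfr
  refine ⟨↥R, inferInstance, (Subalgebra.inclusion hRD).toRingHom, ‹_›, hdim,
    Subalgebra.inclusion_injective hRD, ?_, fun d => ?_, fun r hr => hdom r hr⟩
  · -- essentially of finite type: `k → R → D`
    letI : Algebra ↥R ↥D := (Subalgebra.inclusion hRD).toRingHom.toAlgebra
    haveI : IsScalarTower k ↥R ↥D := IsScalarTower.of_algebraMap_eq fun c => Subtype.ext rfl
    exact Algebra.EssFiniteType.of_comp k ↥R ↥D
  · -- birational: `d = a / s` with `a, s ∈ R`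
    obtain ⟨⟨a, s⟩, h⟩ := IsLocalization.surj (nonZeroDivisors ↥R) (d : K)
    refine ⟨a, (s : ↥R), nonZeroDivisors.ne_zero s.2, Subtype.ext ?_⟩
    have h' : (d : K) * ((s : ↥R) : K) = (a : K) := h
    change ((s : ↥R) : K) * (d : K) = (a : K)
    rw [mul_comm]
    exact h'

/-! ## Entry along a thread: a thread germ dominating a regular two-dimensional `k`-subalgebra of `K` -/

section Thread

open Summit.ResolutionOfSingularities.ResolutionOfSingularities.Theses.HomologicalConductor
open Summit.ResolutionOfSingularities.ResolutionOfSingularities.Theorems.NoZeno.Birth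
open Summit.ResolutionOfSingularities.ResolutionOfSingularities.Theorems.NoZeno.SandwichCluster.Parasite
  (locPrime mem_locPrime_of_mem)
open Summit.ResolutionOfSingularities.ResolutionOfSingularities.Theorems.NoZeno.SandwichCluster.Thread
  (toSubring_le_locPrime isLocalization_locPrime)

/-- The thread germ `D = (T)_(Q)`, `T` a stage of the tower, carries a `k`-algebra structure through `k → T → D` for
which it is essentially of finite type over `k` and whose structure map is `c ↦ algebraMap k K c` inside `K`
(`tn_tower_invariant` + `isLocalization_locPrime`; the construction inside `essFiniteType_inclusion_locPrime`,
recorded for reuse). [this work] -/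
theorem exists_algebra_locPrime_essFiniteType (O : ValuationSubring K) (A : Subalgebra k K)
    (hk : ∀ c : k, algebraMap k K c ∈ O) (hA : A.FG) (hfr : IsFractionRing ↥A K)
    (hAO : A.toSubring ≤ O.toSubring) (m : ℕ) (Q : Ideal ↥(tower O A m)) (hQ : Q.IsPrime) :
    ∃ (_ : Algebra k ↥(locPrime (tower O A m) Q hQ)),
      (∀ c : k, (algebraMap k ↥(locPrime (tower O A m) Q hQ) c : K) = algebraMap k K c) ∧
      Algebra.EssFiniteType k ↥(locPrime (tower O A m) Q hQ) := by
  haveI := hfr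
  obtain ⟨-, -, hET⟩ := tn_tower_invariant O A hk hA hfr hAO m
  haveI := hET
  haveI := hQ
  letI algTD : Algebra ↥(tower O A m) ↥(locPrime (tower O A m) Q hQ) :=
    (Subring.inclusion (toSubring_le_locPrime (tower O A m) Q hQ)).toAlgebra
  haveI := isLocalization_locPrime (tower O A m) Q hQ
  letI algkD : Algebra k ↥(locPrime (tower O A m) Q hQ) :=
    ((algebraMap ↥(tower O A m) ↥(locPrime (tower O A m) Q hQ)).comp (algebraMap k ↥(tower O A m))).toAlgebra
  haveI : IsScalarTower k ↥(tower O A m) ↥(locPrime (tower O A m) Q hQ) :=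
    IsScalarTower.of_algebraMap_eq fun _ => rfl
  haveI : Algebra.EssFiniteType ↥(tower O A m) ↥(locPrime (tower O A m) Q hQ) :=
    Algebra.EssFiniteType.of_isLocalization _ Q.primeCompl
  exact ⟨algkD, fun c => rfl, Algebra.EssFiniteType.comp k ↥(tower O A m) _⟩

/-- **ENTRY INTO THE HABITAT ALONG A THREAD** (Lipman (2.1) HAB-step, thread form): if the thread germ
`D_m = (T_m)_(P_m)` contains and DOMINATES a regular local `k`-subalgebra `R` of `K` of Krull dimension `2` with
`Frac R = K` (e.g. the ring of a local uniformization of a valuation dominating the thread), then `D_m` is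
sandwiched — hence so is every later thread germ (`isSandwichedGerm_locPrime_of_le`), and past the escape stage they
are rational (`hasRationalSingularity_locPrime_of_isSandwichedGerm`).  This is the plumbing that turns a
`Sig.KUnionThread`-type containment «`R ⊆ D_N`, `D_N` dominating `R`» into the entry stub `stub_HabExSw₀` of the
(V26) habitat cut. [this work] -/
theorem isSandwichedGerm_locPrime_of_dominated (O : ValuationSubring K) (A : Subalgebra k K)
    (hk : ∀ c : k, algebraMap k K c ∈ O) (hA : A.FG) (hfr : IsFractionRing ↥A K)
    (hAO : A.toSubring ≤ O.toSubring) (m : ℕ) (Q : Ideal ↥(tower O A m)) (hQ : Q.IsPrime)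
    (R : Subalgebra k K) [IsRegularLocalRing ↥R] (hdim : ringKrullDim ↥R = 2)
    (hRfr : IsFractionRing ↥R K) (hRD : R.toSubring ≤ locPrime (tower O A m) Q hQ)
    (hdom : ∀ r : ↥R, IsUnit (Subring.inclusion hRD r) → IsUnit r) :
    IsSandwichedGerm ↥(locPrime (tower O A m) Q hQ) := by
  obtain ⟨algkD, halg, hET⟩ := exists_algebra_locPrime_essFiniteType O A hk hA hfr hAO m Q hQ
  letI := algkD
  haveI := hET
  haveI := hRfr
  refine ⟨↥R, inferInstance, Subring.inclusion hRD, ‹_›, hdim, Subring.inclusion_injective hRD, ?_,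
    fun d => ?_, fun r hr => hdom r hr⟩
  · -- essentially of finite type: `k → R → D_m`
    letI : Algebra ↥R ↥(locPrime (tower O A m) Q hQ) := (Subring.inclusion hRD).toAlgebra
    haveI : IsScalarTower k ↥R ↥(locPrime (tower O A m) Q hQ) := by
      refine IsScalarTower.of_algebraMap_eq fun c => Subtype.ext ?_
      refine (halg c).trans ?_
      rfl
    exact Algebra.EssFiniteType.of_comp k ↥R _
  · -- birational: `d = a / s` with `a, s ∈ R`
    obtain ⟨⟨a, s⟩, h⟩ := IsLocalization.surj (nonZeroDivisors ↥R) (d : K)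
    refine ⟨a, (s : ↥R), nonZeroDivisors.ne_zero s.2, Subtype.ext ?_⟩
    have h' : (d : K) * ((s : ↥R) : K) = (a : K) := h
    change ((s : ↥R) : K) * (d : K) = (a : K)
    rw [mul_comm]
    exact h'

end Thread

/-! ## EXHAUSTION LOCALISES THE THREAD: under `Exhausts O A` the union of the thread germs is a coarsening of `O`

If the stages exhaust `O` (`⋃ T_m = O`, `Parasite.Exhausts`), then for every compatible prime thread `(P_m)` the
set `𝔔 := {x ∈ O | x ∈ P_m for some (equivalently every) stage containing x}` is a prime ideal of `O`, the
coarsening `W := O_𝔔` (Mathlib `ValuationSubring.ofPrime`) CONTAINS every thread germ `D_m = (T_m)_(P_m)`, is their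
UNION, and DOMINATES each of them.  So in the exhaustive case the (K∪-thread) input of the habitat entry holds in
its strongest form «`⋃_m D_m` is a valuation ring of `K` dominating the thread», and the thread is the thread of
centres of the coarsening `W`; entry into the sandwiched habitat then only needs a local uniformization of `W` with a
two-dimensional centre inside `⋃ D_m` (`isSandwichedGerm_locPrime_of_dominated`).  In rank one this is vacuous
(`Parasite.not_exhausts_of_singularThread`: exhaustive rank-one towers carry no singular thread). -/

section Exhaustion

open Summit.ResolutionOfSingularities.ResolutionOfSingularities.Theses.HomologicalConductor
open Summit.ResolutionOfSingularities.ResolutionOfSingularities.Theorems.NoZeno.Birth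
open Summit.ResolutionOfSingularities.ResolutionOfSingularities.Theorems.NoZeno.SandwichCluster.Parasite
  (locPrime mem_locPrime_iff mem_locPrime_of_mem Exhausts ne_zero_of_not_mem_ideal)

variable (O : ValuationSubring K) (A : Subalgebra k K)
  (P : ∀ m : ℕ, Ideal ↥(tower O A m)) (hP : ∀ m, (P m).IsPrime)
  (hcompat : ∀ (m : ℕ) (x : K) (hx : x ∈ tower O A m) (hx' : x ∈ tower O A (m + 1)),
    (⟨x, hx'⟩ : ↥(tower O A (m + 1))) ∈ P (m + 1) ↔ (⟨x, hx⟩ : ↥(tower O A m)) ∈ P m)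

include hcompat in
/-- **Membership in a compatible thread is stage-independent**: for `s ∈ T_m ⊆ T_n`, `s ∈ P_n ↔ s ∈ P_m`.
[this work] -/
theorem mem_thread_iff_of_le {m n : ℕ} (hmn : m ≤ n) {s : K} (hs : s ∈ tower O A m)
    (hs' : s ∈ tower O A n) :
    (⟨s, hs'⟩ : ↥(tower O A n)) ∈ P n ↔ (⟨s, hs⟩ : ↥(tower O A m)) ∈ P m := by
  induction hmn with
  | refl => exact Iff.rfl
  | @step j hj ih =>
    have hsj : s ∈ tower O A j := d2rc_mem_tower_of_le O A hj hs
    exact (hcompat j s hsj hs').trans (ih hsj)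

include hcompat in
/-- **EXHAUSTION LOCALISES THE THREAD.**  If the stages exhaust `O`, then for every compatible prime thread
`(P_m)` there is a valuation ring `W` of `K` with `O ≤ W` (a coarsening: `W = O_𝔔` for the prime
`𝔔 = ⋃_m P_m ∩ O` of `O`) such that (i) every thread germ `D_m = (T_m)_(P_m)` lies in `W`, (ii) `W = ⋃_m D_m`,
and (iii) `W` DOMINATES each `D_m` (`SubringDominates`: an element of `D_m` invertible in `W` is invertible in
`D_m`).  [this work] -/
theorem exists_coarsening_of_exhausts (hk : ∀ c : k, algebraMap k K c ∈ O) (hAO : A.toSubring ≤ O.toSubring)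
    (hexh : Exhausts O A) :
    ∃ W : ValuationSubring K, O ≤ W ∧
      (∀ m, SubringDominates (locPrime (tower O A m) (P m) (hP m)) W.toSubring) ∧
      (∀ x : K, x ∈ W → ∃ m, x ∈ locPrime (tower O A m) (P m) (hP m)) := by
  have hTO : ∀ (m : ℕ) (x : K), x ∈ tower O A m → x ∈ O := mem_valuationSubring_of_mem_tower O hk hAO
  -- the thread prime of `O`
  let 𝔔 : Ideal ↥O :=
    { carrier := {x | ∃ (m : ℕ) (hx : (x : K) ∈ tower O A m), (⟨x, hx⟩ : ↥(tower O A m)) ∈ P m}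
      add_mem' := by
        rintro x y ⟨m, hx, hxP⟩ ⟨n, hy, hyP⟩
        have hx' : (x : K) ∈ tower O A (max m n) := d2rc_mem_tower_of_le O A (le_max_left m n) hx
        have hy' : (y : K) ∈ tower O A (max m n) := d2rc_mem_tower_of_le O A (le_max_right m n) hy
        refine ⟨max m n, (tower O A (max m n)).add_mem hx' hy', ?_⟩
        have hsum : (⟨((x + y : ↥O) : K), (tower O A (max m n)).add_mem hx' hy'⟩ : ↥(tower O A (max m n))) =
            ⟨x, hx'⟩ + ⟨y, hy'⟩ := Subtype.ext rfl
        rw [hsum]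
        exact (P _).add_mem ((mem_thread_iff_of_le O A P hcompat (le_max_left m n) hx hx').mpr hxP)
          ((mem_thread_iff_of_le O A P hcompat (le_max_right m n) hy hy').mpr hyP)
      zero_mem' := ⟨0, (tower O A 0).zero_mem, by
        have : (⟨((0 : ↥O) : K), (tower O A 0).zero_mem⟩ : ↥(tower O A 0)) = 0 := Subtype.ext rfl
        rw [this]; exact (P 0).zero_mem⟩
      smul_mem' := by
        rintro r x ⟨m, hx, hxP⟩
        obtain ⟨n, hr⟩ := hexh r r.2
        have hx' : (x : K) ∈ tower O A (max m n) := d2rc_mem_tower_of_le O A (le_max_left m n) hx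
        have hr' : (r : K) ∈ tower O A (max m n) := d2rc_mem_tower_of_le O A (le_max_right m n) hr
        refine ⟨max m n, (tower O A (max m n)).mul_mem hr' hx', ?_⟩
        have hprod : (⟨((r • x : ↥O) : K), (tower O A (max m n)).mul_mem hr' hx'⟩ : ↥(tower O A (max m n))) =
            ⟨r, hr'⟩ * ⟨x, hx'⟩ := Subtype.ext rfl
        rw [hprod]
        exact (P _).mul_mem_left _ ((mem_thread_iff_of_le O A P hcompat (le_max_left m n) hx hx').mpr hxP) }
  have hmem𝔔 : ∀ x : ↥O, x ∈ 𝔔 ↔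
      ∃ (m : ℕ) (hx : (x : K) ∈ tower O A m), (⟨x, hx⟩ : ↥(tower O A m)) ∈ P m := fun _ => Iff.rfl
  -- membership in `𝔔` can be tested at any stage containing the element
  have hstage : ∀ (x : ↥O) (m : ℕ) (hx : (x : K) ∈ tower O A m),
      x ∈ 𝔔 ↔ (⟨x, hx⟩ : ↥(tower O A m)) ∈ P m := by
    intro x m hx
    rw [hmem𝔔]
    constructor
    · rintro ⟨n, hxn, hxP⟩
      have hx' : (x : K) ∈ tower O A (max m n) := d2rc_mem_tower_of_le O A (le_max_left m n) hx
      exact (mem_thread_iff_of_le O A P hcompat (le_max_left m n) hx hx').mp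
        ((mem_thread_iff_of_le O A P hcompat (le_max_right m n) hxn hx').mpr hxP)
    · exact fun h => ⟨m, hx, h⟩
  haveI h𝔔 : 𝔔.IsPrime := by
    refine ⟨?_, ?_⟩
    · rw [Ideal.ne_top_iff_one]
      rintro ⟨m, h1, h1P⟩
      have : (⟨((1 : ↥O) : K), h1⟩ : ↥(tower O A m)) = 1 := Subtype.ext rfl
      rw [this] at h1P
      exact (hP m).ne_top ((P m).eq_top_of_isUnit_mem h1P isUnit_one)
    · rintro x y ⟨m, hxy, hxyP⟩
      obtain ⟨a, ha⟩ := hexh x x.2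
      obtain ⟨b, hb⟩ := hexh y y.2
      set N := max m (max a b)
      have hxN : (x : K) ∈ tower O A N := d2rc_mem_tower_of_le O A ((le_max_left a b).trans (le_max_right m _)) ha
      have hyN : (y : K) ∈ tower O A N := d2rc_mem_tower_of_le O A ((le_max_right a b).trans (le_max_right m _)) hb
      have hxyN : ((x * y : ↥O) : K) ∈ tower O A N := d2rc_mem_tower_of_le O A (le_max_left m _) hxy
      have hxyPN : (⟨((x * y : ↥O) : K), hxyN⟩ : ↥(tower O A N)) ∈ P N :=
        (mem_thread_iff_of_le O A P hcompat (le_max_left m _) hxy hxyN).mpr hxyP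
      have hprod : (⟨((x * y : ↥O) : K), hxyN⟩ : ↥(tower O A N)) = ⟨x, hxN⟩ * ⟨y, hyN⟩ := Subtype.ext rfl
      rw [hprod] at hxyPN
      haveI := hP N
      rcases (hP N).mem_or_mem hxyPN with h | h
      · exact Or.inl ((hstage x N hxN).mpr h)
      · exact Or.inr ((hstage y N hyN).mpr h)
  refine ⟨ValuationSubring.ofPrime O 𝔔, ValuationSubring.le_ofPrime O 𝔔, fun m => ⟨?_, ?_⟩, ?_⟩
  · -- (i) `D_m ≤ W`
    rintro y ⟨a, b, ha, hb, hbP, rfl⟩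
    have hb𝔔 : (⟨b, hTO m b hb⟩ : ↥O) ∉ 𝔔 := fun h => hbP ((hstage _ m hb).mp h)
    exact ⟨⟨a, hTO m a ha⟩, ⟨b, hTO m b hb⟩, hb𝔔, rfl⟩
  · -- (iii) domination: `y ∈ D_m`, `y⁻¹ ∈ W` ⇒ `y⁻¹ ∈ D_m`
    rintro y ⟨a, b, ha, hb, hbP, rfl⟩ hinv
    have hb0 : b ≠ 0 := ne_zero_of_not_mem_ideal (tower O A m) (P m) hb hbP
    by_cases ha0 : a = 0
    · subst ha0
      have h00 : ((0 : K) * b⁻¹)⁻¹ = 0 * b⁻¹ := by simp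
      rw [h00]
      exact ⟨0, b, (tower O A m).zero_mem, hb, hbP, rfl⟩
    have haP : (⟨a, ha⟩ : ↥(tower O A m)) ∉ P m := by
      intro haP
      have ha𝔔 : (⟨a, hTO m a ha⟩ : ↥O) ∈ 𝔔 := (hstage _ m ha).mpr haP
      -- `a` is a unit of `W`: `a⁻¹ = b⁻¹ · (a b⁻¹)⁻¹`… with `b⁻¹ ∈ W` and `(a b⁻¹)⁻¹ ∈ W`
      have hb𝔔 : (⟨b, hTO m b hb⟩ : ↥O) ∉ 𝔔 := fun h => hbP ((hstage _ m hb).mp h)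
      have hbinvW : b⁻¹ ∈ ValuationSubring.ofPrime O 𝔔 :=
        ⟨1, ⟨b, hTO m b hb⟩, hb𝔔, by simp⟩
      have hainvW : a⁻¹ ∈ ValuationSubring.ofPrime O 𝔔 := by
        have : a⁻¹ = (a * b⁻¹)⁻¹ * b⁻¹ := by field_simp
        rw [this]
        exact Subring.mul_mem _ hinv hbinvW
      -- but an element of `𝔔` is not a unit of `W = O_𝔔`
      have hval := (ValuationSubring.ofPrime_valuation_eq_one_iff_mem_primeCompl O 𝔔 ⟨a, hTO m a ha⟩).not.mpr
        (fun h => h ha𝔔)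
      apply hval
      have haW : a ∈ ValuationSubring.ofPrime O 𝔔 := ValuationSubring.le_ofPrime O 𝔔 (hTO m a ha)
      have hunit : IsUnit (⟨a, haW⟩ : ↥(ValuationSubring.ofPrime O 𝔔)) :=
        (isUnit_subring_iff_inv_mem (R := (ValuationSubring.ofPrime O 𝔔).toSubring) ⟨a, haW⟩).mpr
          ⟨ha0, hainvW⟩
      exact ((ValuationSubring.ofPrime O 𝔔).valuation_eq_one_iff ⟨a, haW⟩).mp hunit
    have : (a * b⁻¹)⁻¹ = b * a⁻¹ := by rw [mul_inv, inv_inv, mul_comm]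
    rw [this]
    exact ⟨b, a, hb, ha, haP, rfl⟩
  · -- (ii) `W ⊆ ⋃ D_m`
    rintro x ⟨a, s, hs, rfl⟩
    obtain ⟨m, ha⟩ := hexh a a.2
    obtain ⟨n, hsn⟩ := hexh s s.2
    have ha' : (a : K) ∈ tower O A (max m n) := d2rc_mem_tower_of_le O A (le_max_left m n) ha
    have hs' : (s : K) ∈ tower O A (max m n) := d2rc_mem_tower_of_le O A (le_max_right m n) hsn
    have hsP : (⟨(s : K), hs'⟩ : ↥(tower O A (max m n))) ∉ P (max m n) :=
      fun h => hs ((hstage s _ hs').mpr h)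
    exact ⟨max m n, a, s, ha', hs', hsP, rfl⟩

end Exhaustion

end Summit.ResolutionOfSingularities.ResolutionOfSingularities.Theorems.NoZeno.Sandwiched

end
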